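import Summits.BirchSwinnertonDyer.Rank1Residual.F1Sign2.DescentSignShaAtTwo
import Summits.BirchSwinnertonDyer.BirchSwinnertonDyer.Theorems.GenusKolyvaginAtTwoGenusPrimitiveSupplyAtTwoArchimedeanRelaxedSwitchEgg
import Summits.BirchSwinnertonDyer.BirchSwinnertonDyer.Theorems.GenusKolyvaginAtTwoEquivariantKolyvaginExactAtTwoEigenClassesFinite
import Summits.BirchSwinnertonDyer.BirchSwinnertonDyer.Theorems.ByReductionTypeAtTwoRankOneAtTwoBigImageOddLocalOneDoorKummerRestriction
import Literature.NumberTheory.EllipticCurves.ArchimedeanLocalConditionTorsion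
import Literature.NumberTheory.EllipticCurves.ArchimedeanLocalCondition
import Literature.NumberTheory.EllipticCurves.HeegnerPointsKolyvaginPrimaryLeavesProofs
import Literature.NumberTheory.EllipticCurves.QuadraticTwistRank
import Literature.NumberTheory.EllipticCurves.LeadingTermHeegnerProofs
import Literature.NumberTheory.EllipticCurves.MordellWeilTheoremProofs
import Literature.NumberTheory.EllipticCurves.ComplexMultiplication
import HarnessLib

/-!
# Route `GenusKolyvaginAtTwo`, crux #2 `GenusPrimitiveSupplyAtTwo` (stmt-BirchSwinnertonDyer-22136):
# AN-10K `F1Sign2.DescentSignShaOverImagQuadratic` BY NAME, FINITENESS-FREE —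
# `ε(E) = −1 ⟹ Ш(E/K)[2] ≠ 0` for every imaginary quadratic `K = ℚ(√d)` with `rank E^{(d)}(ℚ) = 0`

Width seat `bsd-line-gk2-p5` g17 (cell `bsd-f1-sign2`, SUPPLY lineage of crux 22136), file 47 of the series; sequel of files 28/29
(`…ArchimedeanRelaxedSwitch[Egg]`: Mazur–Rubin Lemma 3.2 at `T = {∞}` and `[Sel₂^{rel ∞}(E) : Sel₂(E)] = 2 ⟺ ε = −1`) and of file 22
(`…ArchimedeanEgg`: the egg is the real place of `Sel₂`). THEOREMS ONLY (no definition, no named fact, no `sorry`, no local instance);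
helper `--supports stmt-BirchSwinnertonDyer-22136`; no item is closed; BSD is not proved by any of this.

WHAT. The cell's typed row AN-10K (`Summits/…/F1Sign2/DescentSignShaAtTwo.lean`, `-an` g4 / REF1 §24.1: "theorem-grade descent,
in-print-assembly Kramer 1981 Thm 1 + Prop 6") is proved BY NAME (`descentSignShaOverImagQuadratic_holds`), with NO finiteness of `Ш`,
no parity and no `L`-function:

* §200 `resBaseChange_torsionH1ToH1_mem_sha_of_mem_relaxed` — for `x ∈ Sel₂^{rel ∞}(W)` and `K` totally complex, `res_K [x] ∈ Ш(E_K/K)`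
  (finite places: the condition over `ℚ_v` implies the one over `K_w ⊇ ℚ_v`, the tree's `localRestrictionKer_le_of_tower` /
  `mem_localRestrictionKer_iff_resBaseChange_mem`; complex places: empty); `two_nsmul_resBaseChange_torsionH1ToH1` (`2 · res_K [x] = 0`).
* §201 (points, any quadratic `K/F`): `isOfFinAddOrder_of_conjMap_eq_neg` — `rank V(K) = 1 ≤ rank V(F)` ⟹ every `σ`-anti-fixed point of
  `V(K)` is torsion; `exists_sub_incl_eq_two_smul` — THE DESCENT STEP: `V(K)[2] = 0`, anti-fixed points torsion, `σQ − Q ∈ 2V(K)` ⟹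
  `Q ≡ ι Q''  (mod 2V(K))` with `Q'' ∈ V(F)` (Kramer 1981, proof of Thm. 1).
* §202 `mordellWeilRank_baseChange_eq_add_of_sq_eq` (`rank E(K) = rank E(ℚ) + rank E^{(c)}(ℚ)` for `K ∋ θ`, `θ² = c`, Silverman Ex. 10.16
  on `finrank`s), `infinitePlace_isComplex_of_sq_eq_intCast`, and **`descentSignShaOverImagQuadratic_holds : F1Sign2.DescentSignShaOverImagQuadratic`**:
  `ε = −1` gives `x ∈ Sel₂^{rel ∞}(E) ∖ Sel₂(E)`; `c = res_K [x] ∈ Ш(E_K/K)[2]`; if `c = 0` then `res_K x = κ_K(Q)` (Kummer exactness over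
  `K`), `κ_K(σQ) = κ_K(Q)` (`conjAct_resTorsion`, `conjAct_kummerMapTorsion`), `rank E(K) = 1 + 0`, so §201 gives `Q ≡ ι Q''`, whence
  `res_K x = res_K κ_ℚ(Q'')` (`RankOneAtTwoOneDoor.resTorsion_kummerMapTorsion`) and `x = κ_ℚ(Q'') ∈ Sel₂(E)` by the injectivity of
  `res_K` on `H¹(ℚ, E[2])` (`E(K)[2] = 0`, `GenusExact.EigenClassesFinite.resTorsion_injective_of_noTorsion`) — contradiction.

Honest framing: Kramer 1981 Thm. 1 / Prop. 6 bookkeeping (the relaxed-at-`∞` class becomes a `Ш(E/K)[2]`-class over an imaginary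
quadratic field in which the twist acquires no rank), kernel-new as a finiteness-free theorem over the tree's `Ш`; beyond-print theorem:
no. -an's reading (MEMO-an §2 AN-10): this is the descent fact whose BSD₂-shadow is the D9 law `ε = −1 ⇒ 4 ∣ x⁻(1/4)`. Crux 22136 stays
OPEN exactly at (U) 24947 ∧ (CONV₂) 19220/24948. BSD is not proved by any of this.

References: [Kramer1981] Thm. 1, §2 Prop. 6; [SilvermanAEC2009] VIII.§2, X.§4 (Thm. X.4.2 (a)), Exercise 10.16; [MazurRubin2010]
Lemma 3.2; [SerreGaloisCohomology1997] I.§2.4, I.§2.6 (b); [GrossLMS1991] §5 (5.1).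
-/

set_option linter.dupNamespace false -- tree convention: `Summit.BirchSwinnertonDyer.BirchSwinnertonDyer.Theorems` (summit = sub-problem)
set_option autoImplicit false

noncomputable section

open scoped Classical

namespace Summit.BirchSwinnertonDyer.BirchSwinnertonDyer.Theorems.GenusKolyArch

open WeierstrassCurve NumberField IsDedekindDomain Field Module
open Literature.NumberTheory.EllipticCurves Literature.NumberTheory.GaloisRepresentations
open Summit.BirchSwinnertonDyer.Rank1Residual.F1Sign2 (selmerGroupRelaxedAtInfinityAtTwo DescentSignShaOverImagQuadratic)

/-! ## §200 The ∞-relaxed Selmer group restricts into `Ш(E/K)[2]` over a totally complex `K` -/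

section Relaxed

variable (W : WeierstrassCurve ℚ) (K : Type) [Field K] [NumberField K]

/-- **`res_K` of an ∞-relaxed `2`-Selmer class is locally trivial everywhere over a totally complex `K`.** For
`x ∈ Sel₂^{rel ∞}(W) ⊆ H¹(ℚ, W[2])` (the local Kummer condition at every FINITE place of `ℚ`, none at `∞`) and a number field
`K` all of whose infinite places are complex, the restriction to `K` of the image `[x] ∈ H¹(ℚ, E)` lies in `Ш(E_K/K)`: at a finite
place `w ∣ v` of `K` the class dies over `ℚ_v`, hence over `K_w ⊇ ℚ_v` (`localRestrictionKer_le_of_tower`); at a complex place the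
condition is empty (`localRestrictionKer_eq_top_of_isAlgClosed`). [cite: Kramer1981, §2 (proof of Thm. 1, the map S¹(E) → Sel(E/K))]
[cite: SerreGaloisCohomology1997, I.§2.4] -/
theorem resBaseChange_torsionH1ToH1_mem_sha_of_mem_relaxed (hK : ∀ w : InfinitePlace K, w.IsComplex)
    {x : W.galH1Torsion ((2 : ℕ) : ℤ)} (hx : x ∈ selmerGroupRelaxedAtInfinityAtTwo W) :
    resBaseChange W K (torsionH1ToH1 W ((2 : ℕ) : ℤ) x) ∈ (W.baseChange K).sha := by
  have hfin : ∀ v : HeightOneSpectrum (𝓞 ℚ),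
      torsionH1ToH1 W ((2 : ℕ) : ℤ) x ∈ W.localRestrictionKer (v.adicCompletion ℚ) := fun v ↦
    (mem_selmerLocalKer_iff_torsionH1ToH1_mem W (v.adicCompletion ℚ) x).mp (AddSubgroup.mem_iInf.mp hx v)
  rw [WeierstrassCurve.mem_sha_iff]
  refine ⟨fun w ↦ ?_, fun w ↦ ?_⟩
  · -- finite places: `w ∣ v := w ∩ ℤ`
    let v : HeightOneSpectrum (𝓞 ℚ) := w.under (𝓞 ℚ)
    haveI : w.asIdeal.LiesOver v.asIdeal := ⟨rfl⟩
    letI : Algebra (v.adicCompletion ℚ) (w.adicCompletion K) :=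
      (adicCompletionMap (K := ℚ) K v w).toAlgebra
    haveI : IsScalarTower ℚ (v.adicCompletion ℚ) (w.adicCompletion K) :=
      IsScalarTower.of_algebraMap_eq fun y ↦ (adicCompletionMap_coe (K := ℚ) K v w y).symm
    exact (mem_localRestrictionKer_iff_resBaseChange_mem W _).mp
      (localRestrictionKer_le_of_tower W (E := v.adicCompletion ℚ) (hfin v))
  · -- complex places: no condition
    haveI : IsAlgClosed w.Completion :=
      isAlgClosed_of_ringEquiv (InfinitePlace.Completion.ringEquivComplexOfIsComplex (hK w)).symm
    rw [localRestrictionKer_eq_top_of_isAlgClosed]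
    trivial

/-- The restricted class is `2`-torsion: `2 • res_K [x] = 0` in `H¹(K, E_K)` (`H¹(ℚ, W[2])` is killed by `2`). [folklore] -/
theorem two_nsmul_resBaseChange_torsionH1ToH1 (x : W.galH1Torsion ((2 : ℕ) : ℤ)) :
    2 • resBaseChange W K (torsionH1ToH1 W ((2 : ℕ) : ℤ) x) = 0 := by
  rw [← map_nsmul, ← map_nsmul, ← natCast_zsmul, zsmul_discreteH1_torsion ((2 : ℕ) : ℤ) x, map_zero, map_zero]

/-- `res_K [x] = [res_K x]`: restriction commutes with `H¹(·, E[2]) → H¹(·, E)` (`torsionH1ToH1_resTorsion`). [folklore] -/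
theorem resBaseChange_torsionH1ToH1_eq (x : W.galH1Torsion ((2 : ℕ) : ℤ)) :
    resBaseChange W K (torsionH1ToH1 W ((2 : ℕ) : ℤ) x) =
      torsionH1ToH1 (W.baseChange K) ((2 : ℕ) : ℤ) (resTorsion W K ((2 : ℕ) : ℤ) x) :=
  (torsionH1ToH1_resTorsion W K ((2 : ℕ) : ℤ) x).symm

end Relaxed

/-! ## §201 Points over a quadratic extension: anti-fixed points are torsion when the rank does not grow; the descent step -/

section Points

variable {F : Type*} {K : Type*} [Field F] [Field K] [Algebra F K]

open WeierstrassCurve.QuadraticDescent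

/-- **Anti-fixed points are torsion when `rank V(K) = 1 ≤ rank V(F)`.** For an extension `K/F`, an `F`-endomorphism `σ` of `K`,
`V(K)` finitely generated of rank `1` and `rank V(F) ≥ 1` (so some `P₀ ∈ V(F)` has infinite order): every `R ∈ V(K)` with `σR = −R`
has finite order (`a R = b ι P₀` with `a, b ≠ 0` by rank one; applying `σ` gives `−aR = aR`). Silverman, *AEC*, Exercise 10.16 (the `−1`-eigenspace
of `Gal(K/F)` on `E(K) ⊗ ℚ` is `E^{(d)}(F) ⊗ ℚ`). [cite: SilvermanAEC2009, Exercise 10.16] -/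
theorem isOfFinAddOrder_of_conjMap_eq_neg (V : WeierstrassCurve F) (σ : K →ₐ[F] K)
    [Module.Finite ℤ (V.baseChange K).toAffine.Point] (hrk : (V.baseChange K).mordellWeilRank = 1)
    (hrF : 1 ≤ V.mordellWeilRank)
    {R : (V.baseChange K).toAffine.Point} (hR : conjMap V σ R = -R) : IsOfFinAddOrder R := by
  obtain ⟨P₀, hP₀⟩ :=
    Literature.NumberTheory.EllipticCurves.exists_not_isOfFinAddOrder_of_one_le_finrank (M := V.toAffine.Point) hrF
  by_contra hRt
  have hι : ¬ IsOfFinAddOrder (incl K V P₀) := fun h ↦ hP₀ (isOfFinAddOrder_of_incl V h)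
  obtain ⟨a, b, ha, -, hab⟩ :=
    Literature.NumberTheory.EllipticCurves.exists_smul_eq_smul_of_finrank_eq_one
      (M := (V.baseChange K).toAffine.Point) hrk hRt hι
  have e1 : a • conjMap V σ R = a • R := by
    rw [← map_zsmul, hab, map_zsmul, conjMap_incl V σ P₀]
  rw [hR, smul_neg, neg_eq_iff_add_eq_zero, ← two_nsmul, ← natCast_zsmul, smul_smul] at e1
  exact hRt (isOfFinAddOrder_iff_zsmul_eq_zero.mpr ⟨((2 : ℕ) : ℤ) * a, mul_ne_zero (by norm_num) ha, e1⟩)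

/-- **The descent step.** `K/F` quadratic (`2 ≠ 0`), `σ ≠ id` an involutive `F`-endomorphism of `K`, `V(K)[2] = 0`, and every
`σ`-anti-fixed point of `V(K)` torsion. If `Q ∈ V(K)` has `σQ − Q = 2R₁` then `Q ≡ ι Q''` modulo `2V(K)` for some `Q'' ∈ V(F)`:
`R₁` is anti-fixed (`2(σR₁ + R₁) = σ(σQ − Q) + (σQ − Q) = 0`), hence torsion of odd order, hence `R₁ ∈ 2V(K)`; and `Q + R₁` is
`σ`-fixed, hence `F`-rational (Galois descent of points). Kramer 1981, proof of Thm. 1 (`E(K)/2E(K)` versus `E(ℚ)/2E(ℚ) ⊕ E^D(ℚ)/2E^D(ℚ)`).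
[cite: Kramer1981, Thm. 1 (proof)] [cite: SilvermanAEC2009, Exercise 10.16] -/
theorem exists_sub_incl_eq_two_smul [NeZero (2 : F)] (h2 : finrank F K = 2) (V : WeierstrassCurve F)
    {σ : K →ₐ[F] K} (hσ : σ ≠ AlgHom.id F K) (hσσ : ∀ z, σ (σ z) = z)
    (h2t : ∀ P : (V.baseChange K).toAffine.Point, 2 • P = 0 → P = 0)
    (hanti : ∀ R : (V.baseChange K).toAffine.Point, conjMap V σ R = -R → IsOfFinAddOrder R)
    {Q R₁ : (V.baseChange K).toAffine.Point} (hQ : conjMap V σ Q - Q = ((2 : ℕ) : ℤ) • R₁) :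
    ∃ (Q'' : V.toAffine.Point) (S : (V.baseChange K).toAffine.Point),
      Q - incl K V Q'' = ((2 : ℕ) : ℤ) • S := by
  rw [natCast_zsmul] at hQ
  -- `R₁` is anti-fixed
  have hR₁ : conjMap V σ R₁ = -R₁ := by
    have h : 2 • (conjMap V σ R₁ + R₁) = 0 := by
      rw [smul_add, ← map_nsmul, ← hQ, map_sub, conjMap_conjMap V hσσ]
      abel
    exact (neg_eq_of_add_eq_zero_left (h2t _ h)).symm
  -- hence torsion of odd order, hence in `2 V(K)`
  obtain ⟨s, hs⟩ := Literature.NumberTheory.EllipticCurves.exists_pow_smul_eq_of_isOfFinAddOrder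
    Nat.prime_two h2t (hanti R₁ hR₁) 1
  rw [pow_one, natCast_zsmul] at hs
  -- `Q + R₁` is `σ`-fixed, hence rational
  have hfix : conjMap V σ (Q + R₁) = Q + R₁ := by
    rw [map_add, hR₁, (sub_eq_iff_eq_add.mp hQ), two_nsmul]
    abel
  obtain ⟨Q'', hQ''⟩ := exists_incl_eq_of_conjMap_eq h2 V hσ hfix
  refine ⟨Q'', -s, ?_⟩
  rw [hQ'', natCast_zsmul, smul_neg, hs]
  abel

end Points

/-! ## §202 The quadratic base change over `ℚ`: rank bookkeeping and the assembly of AN-10K -/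

section Main

variable (W : WeierstrassCurve ℚ) [W.IsElliptic] (K : Type) [Field K] [NumberField K]

open WeierstrassCurve.QuadraticDescent

/-- A field containing a square root of a negative integer has no real place. [folklore] -/
theorem infinitePlace_isComplex_of_sq_eq_intCast {L : Type*} [Field L] {i : L} {d : ℤ} (hi : i ^ 2 = (d : L))
    (hd : d < 0) (w : InfinitePlace L) : w.IsComplex := by
  rw [← InfinitePlace.not_isReal_iff_isComplex]
  intro hw
  have h : ((InfinitePlace.embedding_of_isReal hw i : ℝ) : ℂ) ^ 2 = (d : ℂ) := by
    rw [InfinitePlace.embedding_of_isReal_apply, ← map_pow, hi, map_intCast]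
  have h' : (InfinitePlace.embedding_of_isReal hw i : ℝ) ^ 2 = (d : ℝ) := by exact_mod_cast h
  have hd' : (d : ℝ) < 0 := by exact_mod_cast hd
  nlinarith [sq_nonneg (InfinitePlace.embedding_of_isReal hw i)]

/-- **`rank E(K) = rank E(ℚ) + rank E^{(c)}(ℚ)` for `K = ℚ(θ)`, `θ² = c`** (Silverman, *AEC*, Exercise 10.16; the tree's cardinal
identity `lift_rank_point_baseChange_quadratic` read on `finrank`s by Mordell–Weil over `K`). [cite: SilvermanAEC2009, Exercise 10.16] -/
theorem mordellWeilRank_baseChange_eq_add_of_sq_eq (h2 : finrank ℚ K = 2) {θ : K} {c : ℚ}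
    (hθ : θ ∉ Set.range (algebraMap ℚ K)) (hc : θ ^ 2 = algebraMap ℚ K c) :
    (W.baseChange K).mordellWeilRank = W.mordellWeilRank + (W.quadraticTwist c).mordellWeilRank := by
  haveI : (W.baseChange K).IsElliptic := inferInstanceAs ((W.map (algebraMap ℚ K)).IsElliptic)
  haveI : Module.Finite ℤ (W.baseChange K).toAffine.Point := (W.baseChange K).module_finite_point_holds
  have h := lift_rank_point_baseChange_quadratic W h2 hθ hc
  simp only [Cardinal.lift_id] at h
  have hfin : Module.rank ℤ (W.baseChange K).toAffine.Point < Cardinal.aleph0 := Module.rank_lt_aleph0 ℤ _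
  rw [h, Cardinal.add_lt_aleph0_iff] at hfin
  unfold WeierstrassCurve.mordellWeilRank Module.finrank
  rw [h, Cardinal.toNat_add hfin.1 hfin.2]

omit [W.IsElliptic] in
/-- `E_K(K̄)` is `2`-divisible (the input `hdiv` of the Kummer map `κ₂` over `K`). [folklore] -/
theorem hdiv_two_baseChange : ∀ P : geomPoints (W.baseChange K), ∃ Q : geomPoints (W.baseChange K), ((2 : ℕ) : ℤ) • Q = P :=
  (W.baseChange K).zsmul_geomPoints_surjective_of_charZero (by norm_num)

/-- **AN-10K `F1Sign2.DescentSignShaOverImagQuadratic` BY NAME** (Kramer 1981, Thm. 1 with Prop. 6, finiteness-free). On the D9 habitat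
(`Δ > 0`, `E(ℚ)[2] = 0`, rank one, `Ш(E)[2] = 0`, `ε(E) = −1` i.e. `¬ MeetsEgg`), for every `d < 0` with `rank E^{(d)}(ℚ) = 0` and every
quadratic number field `K ∋ √d`: `Ш(E/K)` has a non-zero `2`-torsion class. PROOF. `ε = −1` makes `Sel₂(E)` strict at `∞`, so
`[Sel₂^{rel ∞}(E) : Sel₂(E)] = 2` (`relIndex_selmerGroup_selmerGroupRelaxedAtInfinityAtTwo_eq_two_of_not_meetsEgg`, Mazur–Rubin Lemma 3.2 at
`T = {∞}` in the kernel) and there is `x ∈ Sel₂^{rel ∞}(E) ∖ Sel₂(E)`; `K` is totally complex, so `c = res_K [x] ∈ Ш(E_K/K)[2]` (§200). If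
`c = 0` then `res_K x = κ_K(Q)` is a Kummer class (exactness of the Kummer sequence over `K`); `res_K x` is `Gal(K/ℚ)`-invariant
(`conjAct_resTorsion`), so `κ_K(σQ) = κ_K(Q)` and `σQ − Q ∈ 2E(K)`; `rank E(K) = rank E(ℚ) + rank E^{(d)}(ℚ) = 1` (Silverman Ex. 10.16), so
anti-fixed points of `E(K)` are torsion, of odd order as `E(K)[2] = 0` (the `2`-division cubic has no root in a quadratic field), and the
descent step §201 gives `Q ≡ ι Q''` modulo `2E(K)` with `Q'' ∈ E(ℚ)`; then `res_K x = κ_K(ι Q'') = res_K κ_ℚ(Q'')` (naturality of the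
Kummer map) and `res_K` is injective on `H¹(ℚ, E[2])` (`E(K)[2] = 0`, inflation–restriction), so `x = κ_ℚ(Q'') ∈ Sel₂(E)` — a
contradiction. No finiteness of `Ш`, no parity and no `L`-function enter. BSD is not proved by this.
[cite: Kramer1981, Thm. 1, Prop. 6] [cite: SilvermanAEC2009, Exercise 10.16, Thm. X.4.2 (a)] -/
theorem descentSignShaOverImagQuadratic_holds : DescentSignShaOverImagQuadratic := by
  intro W _ _ hS d hd hrank0 K _ _ h2 hi
  obtain ⟨hΔ, hT, hrank, hSha, hegg⟩ := hS
  obtain ⟨i, hi⟩ := hi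
  -- Step 1: an ∞-relaxed Selmer class which is not a Selmer class
  have hidx := relIndex_selmerGroup_selmerGroupRelaxedAtInfinityAtTwo_eq_two_of_not_meetsEgg W hΔ hT hSha hegg
  have hnot : ¬ selmerGroupRelaxedAtInfinityAtTwo W ≤ W.selmerGroup ((2 : ℕ) : ℤ) := by
    intro hle
    rw [← AddSubgroup.relIndex_eq_one] at hle
    omega
  obtain ⟨x, hxR, hxS⟩ := SetLike.not_le_iff_exists.mp hnot
  -- Step 2: its restriction to `K` lies in `Ш(E_K/K)[2]`
  have hK : ∀ w : InfinitePlace K, w.IsComplex := infinitePlace_isComplex_of_sq_eq_intCast hi hd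
  refine ⟨resBaseChange W K (torsionH1ToH1 W _ x), resBaseChange_torsionH1ToH1_mem_sha_of_mem_relaxed W K hK hxR, ?_,
    two_nsmul_resBaseChange_torsionH1ToH1 W K x⟩
  -- Step 3: and is non-zero
  intro hc
  apply hxS
  rw [resBaseChange_torsionH1ToH1_eq] at hc
  -- the square-root generator `i`, `i² = d`
  have hθ : i ∉ Set.range (algebraMap ℚ K) := by
    rintro ⟨q, hq⟩
    have hq2 : algebraMap ℚ K (q ^ 2) = algebraMap ℚ K (d : ℚ) := by rw [map_pow, hq, hi, map_intCast]
    have hq2' : q ^ 2 = (d : ℚ) := (algebraMap ℚ K).injective hq2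
    have hd' : (d : ℚ) < 0 := by exact_mod_cast hd
    nlinarith [sq_nonneg q]
  have hc' : i ^ 2 = algebraMap ℚ K (d : ℚ) := by rw [hi, map_intCast]
  -- `E(K)[2] = 0`
  have h2t : ∀ P : (W.baseChange K).toAffine.Point, 2 • P = 0 → P = 0 :=
    Summit.BirchSwinnertonDyer.Rank1Residual.F1Sign2.EggDoubling.eq_zero_of_two_smul_eq_zero_baseChange W hT h2
  have h2t' : ∀ P : (W.baseChange K).toAffine.Point, ((2 : ℕ) : ℤ) • P = 0 → P = 0 := fun P hP ↦
    h2t P (by rwa [natCast_zsmul] at hP)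
  -- `res_K` is injective on `H¹(ℚ, E[2])`
  have hinj := GenusExact.EigenClassesFinite.resTorsion_injective_of_noTorsion W K h2 hθ hc' ((2 : ℕ) : ℤ) h2t'
  -- `res_K x` is a Kummer class over `K`
  have hdivK := hdiv_two_baseChange W K
  obtain ⟨Q, hQ⟩ := mem_range_kummerMapTorsion_of_torsionH1ToH1_eq_zero (W.baseChange K) _ hdivK _ hc
  -- `res_K x` is `Gal(K/ℚ)`-invariant, hence `κ_K(σ Q) = κ_K(Q)`
  haveI : IsGalois ℚ K := isGalois_of_finrank_eq_two K h2
  set σ₀ : K ≃ₐ[ℚ] K := sigmaQ K h2 hθ hc' with hσ₀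
  have hσinv : conjAct W σ₀ _ (resTorsion W K ((2 : ℕ) : ℤ) x) = resTorsion W K _ x :=
    conjAct_resTorsion K W _ σ₀ h2 (sigmaQ_ne_one K h2 hθ hc') x
  have hκσ : kummerMapTorsion (W.baseChange K) _ hdivK (conjMap W (σ₀ : K →ₐ[ℚ] K) Q) =
      kummerMapTorsion (W.baseChange K) _ hdivK Q := by
    rw [← conjAct_kummerMapTorsion W σ₀ _ hdivK Q, hQ, hσinv]
  -- so `σQ − Q ∈ 2 E(K)`
  have hker : conjMap W (σ₀ : K →ₐ[ℚ] K) Q - Q ∈ (kummerMapTorsion (W.baseChange K) _ hdivK).ker := by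
    rw [AddMonoidHom.mem_ker, map_sub, hκσ, sub_self]
  rw [kummerMapTorsion_ker] at hker
  obtain ⟨R₁, hR₁⟩ := hker
  rw [zsmulAddGroupHom_apply] at hR₁
  -- `rank E(K) = rank E(ℚ) + rank E^{(d)}(ℚ) = 1`
  haveI : (W.baseChange K).IsElliptic := inferInstanceAs ((W.map (algebraMap ℚ K)).IsElliptic)
  haveI : Module.Finite ℤ (W.baseChange K).toAffine.Point := (W.baseChange K).module_finite_point_holds
  have hrkK : (W.baseChange K).mordellWeilRank = 1 := by
    rw [mordellWeilRank_baseChange_eq_add_of_sq_eq W K h2 hθ hc', hrank, hrank0]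
  -- anti-fixed points of `E(K)` are torsion
  have hanti : ∀ R : (W.baseChange K).toAffine.Point, conjMap W (σ₀ : K →ₐ[ℚ] K) R = -R → IsOfFinAddOrder R :=
    fun R hR ↦ isOfFinAddOrder_of_conjMap_eq_neg W (σ₀ : K →ₐ[ℚ] K) hrkK (le_of_eq hrank.symm) hR
  -- the descent step: `Q ≡ ι Q''` modulo `2 E(K)`
  have hσ : (σ₀ : K →ₐ[ℚ] K) ≠ AlgHom.id ℚ K := by
    intro h
    have h1 : (σ₀ : K →ₐ[ℚ] K) i = i := by rw [h, AlgHom.id_apply]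
    have h2' : (σ₀ : K →ₐ[ℚ] K) i = -i := sigmaQ_gen K h2 hθ hc'
    rw [h2', neg_eq_iff_add_eq_zero, ← two_mul, mul_eq_zero] at h1
    rcases h1 with h1 | h1
    · exact two_ne_zero h1
    · exact Literature.NumberTheory.QuadraticFields.Quadratic.ne_zero_of_not_mem_range hθ h1
  have hσσ : ∀ z, (σ₀ : K →ₐ[ℚ] K) ((σ₀ : K →ₐ[ℚ] K) z) = z :=
    fun z ↦ Literature.NumberTheory.QuadraticFields.Quadratic.conj_conj h2 hθ hc' z
  obtain ⟨Q'', S, hQS⟩ := exists_sub_incl_eq_two_smul h2 W hσ hσσ h2t hanti hR₁.symm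
  -- `κ_K(Q) = κ_K(ι Q'') = res_K κ_ℚ(Q'')`
  have hκQ : kummerMapTorsion (W.baseChange K) _ hdivK Q = kummerMapTorsion (W.baseChange K) _ hdivK (incl K W Q'') := by
    rw [← sub_eq_zero, ← map_sub, ← AddMonoidHom.mem_ker, kummerMapTorsion_ker]
    exact ⟨S, by rw [zsmulAddGroupHom_apply, hQS]⟩
  have hres : resTorsion W K ((2 : ℕ) : ℤ) x = resTorsion W K ((2 : ℕ) : ℤ) (kummerMapTorsion W _ (hdiv_two W) Q'') := by
    rw [RankOneAtTwoOneDoor.resTorsion_kummerMapTorsion W K _ (hdiv_two W) hdivK Q'', ← hQ, hκQ]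
    rfl
  -- `res_K` injective: `x = κ_ℚ(Q'') ∈ Sel₂(E)`
  rw [hinj hres]
  exact kummerMapTorsion_mem_selmerGroup W _ (hdiv_two W) Q''

end Main



end Summit.BirchSwinnertonDyer.BirchSwinnertonDyer.Theorems.GenusKolyArch

end
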